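import Mathlib
import Summits.ValiantsHypothesis.ValiantsHypothesis.Theorems.GirthSidonPolySwallowForcesShortRelationSupportSumset
import Summits.ValiantsHypothesis.ValiantsHypothesis.Theorems.GirthSidonPolySwallowForcesShortRelationHonestTargets

/-!
# Route GirthSidon — crux `PolySwallowForcesShortRelation` (stmt-ValiantsHypothesis-6537), line
`two_ended_honesty`: the COMPLETE-POOL rung (girth × Plünnecke–Ruzsa: `#(A+A) ≳ m^{1.434}`)

Continuation of `Theorems/GirthSidonPolySwallowForcesShortRelationSupportSumset.lean`.  For a
relation-free exponent vector `d` covered by a sumset, `d_i ∈ A + A` (`A` = the pool: any finite set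
containing `0` and the source supports, `PolySwallowSupport.target_mem_sumset`), the two landed engines
eliminate `#A`:

* girth on the pool: `#A^20 > m^19` (`relation_of_sumset_cover_card`, the pure form of
  `PolySwallowSupport.relation_of_support_card`, engine `Theorems.stub_coveringGirth`);
* Plünnecke–Ruzsa + pigeonhole in `60 • A`: `#(A+A)^60 ≥ C(m+29,30) · #A^59`
  (`PolySwallowSupport.relation_of_small_doubling`);

hence `#(A+A)^1200 ≥ C(m+29,30)^20 · #A^1180 > C(m+29,30)^20 · m^1121`
(`sumset_card_large_of_relationFree`), i.e. with `C(m+29,30) ≥ m^30/30!` (`pow_thirty_le_choose`):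
`#(A + A) > m^{1721/1200} / (30!)^{1/60} ≈ 0.29 · m^{1.434}`.

COMPLETE swallowers.  Call a quadratic polynomial swallowing COMPLETE (for the pool `A`) when every pair
sum of the pool is swallowed: `x^e ∈ span(W·W)` for all `e ∈ A + A`, `W = span(1, y)` — the generic
behaviour of a dense source space on its support (census S5 of `Cruxes/MomentCurveElusive/STRATEGY-CENSUS.md`:
generic `V ⊂ ℂ[x]_{≤Δ}` with `C(dim V + 1, 2) ≥ 2Δ + 1` swallows all of `[0, 2Δ]`).  Then the distinct
monomials `x^{A+A}` are independent in `span(W·W)`, which is spanned by the `≤ (s+1)^2` products of the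
generators, so `#(A+A) ≤ (s+1)^2` (`card_sumset_le_of_complete`), and the rung reads
(`relation_of_complete_swallower`): a complete swallowing with `(s+1)^2400 ≤ m^1121 · C(m+29,30)^20` —
asymptotically `s + 1 ≤ 0.97 · m^{0.717}` — has a relation of length `≤ 30`.  Contrapositively a
relation-free complete swallower needs `s ≳ m^{0.717}`, against the Hilbert count `s ≳ 1.41 · m^{1/2}`
(`Cruxes/MomentCurveElusive/LEAD-ANALYSIS-c3.md`, "first open rung": nothing was known beyond `m^{1/2}` for
cancelling coordinates) and against the crux's demand `s ≥ 3.48 · m^{0.9}`.  The general (incomplete)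
swallower is untouched: there `#(A+A)` is not bounded by the source dimension.  VP ≠ VNP is not moved.
[folklore; Plünnecke–Ruzsa cite: TaoVu2006 Cor. 6.29; girth cite: BondySimonovits1974 Thm. 1]
-/

-- Sub = Summit layout duplicates the namespace component
set_option linter.dupNamespace false

namespace Summit.ValiantsHypothesis.ValiantsHypothesis.Theorems

open Polynomial
open scoped Pointwise

namespace PolySwallowSupport

/-- `m^30 ≤ 30! · C(m+29, 30)` (`m^30 ≤ m (m+1) ⋯ (m+29)`). [folklore] -/
theorem pow_thirty_le_choose (m : ℕ) : m ^ 30 ≤ Nat.factorial 30 * Nat.choose (m + 29) 30 := by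
  have h := Nat.pow_succ_le_ascFactorial m 30
  rwa [Nat.ascFactorial_eq_factorial_mul_choose'] at h

/-- **Girth on a sumset cover (pure form).**  For `m ≥ m₀`, an exponent vector covered by `A + A` with
`#A^20 ≤ m^19` has a relation of length `≤ 30`: non-injective `d` gives `{i} ≠ {j}`, injective `d` is
`Theorems.stub_coveringGirth` with `U = A ⊂ ℤ`. [cite: BondySimonovits1974, Thm. 1] -/
theorem relation_of_sumset_cover_card :
    ∃ m₀ : ℕ, ∀ m ≥ m₀, ∀ (d : Fin m → ℕ) (A : Finset ℕ), (∀ i, d i ∈ A + A) →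
      A.card ^ 20 ≤ m ^ 19 →
        ∃ S T : Multiset (Fin m), S ≠ T ∧ Multiset.card S ≤ 30 ∧ Multiset.card T ≤ 30 ∧
          (S.map d).sum = (T.map d).sum := by
  obtain ⟨m₁, hgirth⟩ := stub_coveringGirth
  refine ⟨m₁, fun m hm d A hd hcard => ?_⟩
  classical
  by_cases hinj : Function.Injective d
  swap
  · obtain ⟨i, j, hij, hne⟩ := Function.not_injective_iff.1 hinj
    exact ⟨{i}, {j}, by simpa using hne, by simp, by simp, by simpa using hij⟩
  let Az : Finset ℤ := A.image (fun n : ℕ => (n : ℤ))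
  have hAz : Az.card ^ 20 ≤ m ^ 19 :=
    le_trans (Nat.pow_le_pow_left Finset.card_image_le 20) hcard
  have hcov : ∀ i, ∃ a ∈ Az, ∃ b ∈ Az, (d i : ℤ) = a + b := by
    intro i
    obtain ⟨a, ha, b, hb, hab⟩ := Finset.mem_add.1 (hd i)
    refine ⟨a, Finset.mem_image.2 ⟨a, ha, rfl⟩, b, Finset.mem_image.2 ⟨b, hb, rfl⟩, ?_⟩
    rw [← hab]; push_cast; rfl
  exact hgirth m hm d hinj Az hAz hcov

/-- **The sumset of the pool of a relation-free vector is large: `#(A+A)^1200 > m^1121 · C(m+29,30)^20`.**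
For `m ≥ m₀`: if `d_i ∈ A + A` for all `i` and `d` has no relation of length `≤ 30`, then girth gives
`#A^20 > m^19`, Plünnecke–Ruzsa gives `#(A+A)^60 ≥ C(m+29,30) · #A^59`, and eliminating `#A`,
`#(A+A)^1200 ≥ C(m+29,30)^20 · (#A^20)^59 > C(m+29,30)^20 · m^1121`.  Asymptotically
`#(A+A) > 0.29 · m^{1.434}`. [cite: TaoVu2006, Cor. 6.29] -/
theorem sumset_card_large_of_relationFree :
    ∃ m₀ : ℕ, ∀ m ≥ m₀, ∀ (d : Fin m → ℕ) (A : Finset ℕ), (∀ i, d i ∈ A + A) →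
      (¬ ∃ S T : Multiset (Fin m), S ≠ T ∧ Multiset.card S ≤ 30 ∧ Multiset.card T ≤ 30 ∧
          (S.map d).sum = (T.map d).sum) →
        m ^ 1121 * Nat.choose (m + 29) 30 ^ 20 < (A + A).card ^ 1200 := by
  obtain ⟨m₁, hgirth⟩ := relation_of_sumset_cover_card
  refine ⟨max m₁ 1, fun m hm d A hd hfree => ?_⟩
  have hm₁ : m₁ ≤ m := le_trans (le_max_left _ _) hm
  have hm1 : 1 ≤ m := le_trans (le_max_right _ _) hm
  -- girth: `#A^20 > m^19`
  have hA : m ^ 19 < A.card ^ 20 := by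
    by_contra h
    exact hfree (hgirth m hm₁ d A hd (not_lt.1 h))
  -- Plünnecke–Ruzsa: `#(A+A)^60 ≥ C · #A^59`
  have hAA : Nat.choose (m + 29) 30 * A.card ^ 59 ≤ (A + A).card ^ 60 := by
    by_contra h
    exact hfree (relation_of_small_doubling d A hd (not_le.1 h))
  have hC : 0 < Nat.choose (m + 29) 30 := Nat.choose_pos (by omega)
  -- eliminate `#A`
  have h1 : m ^ 1121 < A.card ^ 1180 := by
    calc m ^ 1121 = (m ^ 19) ^ 59 := by rw [← pow_mul]
      _ < (A.card ^ 20) ^ 59 := Nat.pow_lt_pow_left hA (by norm_num)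
      _ = A.card ^ 1180 := by rw [← pow_mul]
  calc m ^ 1121 * Nat.choose (m + 29) 30 ^ 20
      < A.card ^ 1180 * Nat.choose (m + 29) 30 ^ 20 :=
        Nat.mul_lt_mul_of_pos_right h1 (pow_pos hC 20)
    _ = (Nat.choose (m + 29) 30 * A.card ^ 59) ^ 20 := by ring
    _ ≤ ((A + A).card ^ 60) ^ 20 := Nat.pow_le_pow_left hAA 20
    _ = (A + A).card ^ 1200 := by rw [← pow_mul]

/-- Factorial form: a relation-free vector covered by `A + A` has `m^1721 < (30!)^20 · #(A+A)^1200`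
(`m ≥ m₀`), i.e. `#(A+A) > m^{1721/1200}/(30!)^{1/60} ≈ 0.29 · m^{1.434}`. [cite: TaoVu2006, Cor. 6.29] -/
theorem sumset_card_large_of_relationFree' :
    ∃ m₀ : ℕ, ∀ m ≥ m₀, ∀ (d : Fin m → ℕ) (A : Finset ℕ), (∀ i, d i ∈ A + A) →
      (¬ ∃ S T : Multiset (Fin m), S ≠ T ∧ Multiset.card S ≤ 30 ∧ Multiset.card T ≤ 30 ∧
          (S.map d).sum = (T.map d).sum) →
        m ^ 1721 < Nat.factorial 30 ^ 20 * (A + A).card ^ 1200 := by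
  obtain ⟨m₀, h⟩ := sumset_card_large_of_relationFree
  refine ⟨m₀, fun m hm d A hd hfree => ?_⟩
  have h1 := h m hm d A hd hfree
  have h2 : (m ^ 30) ^ 20 ≤ (Nat.factorial 30 * Nat.choose (m + 29) 30) ^ 20 :=
    Nat.pow_le_pow_left (pow_thirty_le_choose m) 20
  calc m ^ 1721 = m ^ 1121 * (m ^ 30) ^ 20 := by rw [← pow_mul, ← pow_add]
    _ ≤ m ^ 1121 * (Nat.factorial 30 * Nat.choose (m + 29) 30) ^ 20 := Nat.mul_le_mul_left _ h2
    _ = Nat.factorial 30 ^ 20 * (m ^ 1121 * Nat.choose (m + 29) 30 ^ 20) := by ring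
    _ < Nat.factorial 30 ^ 20 * (A + A).card ^ 1200 :=
        Nat.mul_lt_mul_of_pos_left h1 (pow_pos (Nat.factorial_pos 30) 20)

/-- **Complete-pool rung, swallowing level.**  For `m ≥ m₀`, a quadratic polynomial swallowing whose pool
`A ∋ 0` (any finite set containing the source supports) satisfies
`#(A+A)^1200 ≤ m^1121 · C(m+29,30)^20` (asymptotically `#(A+A) ≤ 0.29 · m^{1.434}`) has a relation of
length `≤ 30`, whatever the honesty of the targets. [cite: TaoVu2006, Cor. 6.29] -/
theorem relation_of_complete_pool :
    ∃ m₀ : ℕ, ∀ m ≥ m₀, ∀ (d : Fin m → ℕ) (s : ℕ) (Γ : Fin m → MvPolynomial (Fin s) ℂ)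
      (y : Fin s → ℂ[X]), (∀ i, (Γ i).totalDegree ≤ 2) →
        (∀ i, MvPolynomial.aeval y (Γ i) = (X : ℂ[X]) ^ d i) →
        ∀ A : Finset ℕ, 0 ∈ A → (∀ j, (y j).support ⊆ A) →
          (A + A).card ^ 1200 ≤ m ^ 1121 * Nat.choose (m + 29) 30 ^ 20 →
          ∃ S T : Multiset (Fin m), S ≠ T ∧ Multiset.card S ≤ 30 ∧ Multiset.card T ≤ 30 ∧
            (S.map d).sum = (T.map d).sum := by
  obtain ⟨m₀, h⟩ := sumset_card_large_of_relationFree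
  refine ⟨m₀, fun m hm d s Γ y hΓ hy A h0 hA hsmall => ?_⟩
  by_contra hfree
  exact absurd hsmall (not_le.2 (h m hm d A (target_mem_sumset d Γ y hΓ hy A h0 hA) hfree))

section Complete

variable {K : Type*} [Field K]

/-- **Complete swallowers have a small pool sumset.**  If every pair sum of the pool is swallowed,
`x^e ∈ span(W·W)` for all `e ∈ A + A` with `W = span_K(1, y_1, …, y_s)`, then `#(A+A) ≤ (s+1)^2`:
`span(W·W)` is spanned by the `≤ (s+1)^2` pairwise products of the generators `1, y_1, …, y_s`, and
monomials with distinct exponents are linearly independent (`card_le_finrank_of_subset_natDegrees`).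
(The sharp count is `(s+1)(s+2)/2`.) [folklore] -/
theorem card_sumset_le_of_complete {s : ℕ} (y : Fin s → K[X]) (A : Finset ℕ)
    (hcomp : ∀ e ∈ A + A, ((X : K[X]) ^ e) ∈
      Submodule.span K ((Submodule.span K (insert (1 : K[X]) (Set.range y)) : Set K[X]) *
        (Submodule.span K (insert (1 : K[X]) (Set.range y)) : Set K[X]))) :
    (A + A).card ≤ (s + 1) ^ 2 := by
  classical
  set G : Finset K[X] := Finset.univ.image (Fin.cons (1 : K[X]) y : Fin (s + 1) → K[X]) with hGdef
  have hGset : (insert (1 : K[X]) (Set.range y)) = (G : Set K[X]) := by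
    rw [hGdef, Finset.coe_image, Finset.coe_univ, Set.image_univ, Fin.range_cons]
  set P : Submodule K K[X] := Submodule.span K ((G * G : Finset K[X]) : Set K[X]) with hPdef
  have hspan : Submodule.span K ((Submodule.span K (insert (1 : K[X]) (Set.range y)) : Set K[X]) *
      (Submodule.span K (insert (1 : K[X]) (Set.range y)) : Set K[X])) = P := by
    rw [hPdef, Finset.coe_mul, ← Submodule.span_mul_span, ← Submodule.span_mul_span, hGset,
      Submodule.span_span]
  haveI : Module.Finite K P := Module.Finite.span_of_finite K (G * G).finite_toSet
  have hfin : Module.finrank K P ≤ (s + 1) ^ 2 := by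
    calc Module.finrank K P ≤ (G * G).card := finrank_span_finset_le_card _
      _ ≤ G.card * G.card := Finset.card_mul_le
      _ ≤ (s + 1) * (s + 1) := Nat.mul_le_mul (le_trans Finset.card_image_le (by simp))
          (le_trans Finset.card_image_le (by simp))
      _ = (s + 1) ^ 2 := by ring
  refine le_trans ?_ hfin
  refine card_le_finrank_of_subset_natDegrees P (A + A) fun e he => ?_
  refine ⟨X ^ e, ?_, pow_ne_zero e Polynomial.X_ne_zero, Polynomial.natDegree_X_pow e⟩
  rw [← hspan]
  exact hcomp e he

end Complete

/-- **The rung for COMPLETE swallowers: `s ≳ m^{0.717}`.**  For `m ≥ m₀`, a quadratic polynomial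
swallowing `Γ_i(y) = x^{d_i}` that is complete for a pool `A ∋ 0` containing the source supports (every
`x^e`, `e ∈ A + A`, lies in `span(W·W)`, `W = span(1, y)`) and has `(s+1)^2400 ≤ m^1121 · C(m+29,30)^20`
— asymptotically `s + 1 ≤ 0.97 · m^{0.717}` — admits a relation of length `≤ 30`.  (Hilbert count:
relation-free needs only `(s+1)(s+2)/2 ≥ m`; the crux asks for `s^10 > m^9`.) [cite: TaoVu2006, Cor. 6.29] -/
theorem relation_of_complete_swallower :
    ∃ m₀ : ℕ, ∀ m ≥ m₀, ∀ (d : Fin m → ℕ) (s : ℕ) (Γ : Fin m → MvPolynomial (Fin s) ℂ)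
      (y : Fin s → ℂ[X]), (∀ i, (Γ i).totalDegree ≤ 2) →
        (∀ i, MvPolynomial.aeval y (Γ i) = (X : ℂ[X]) ^ d i) →
        ∀ A : Finset ℕ, 0 ∈ A → (∀ j, (y j).support ⊆ A) →
          (∀ e ∈ A + A, ((X : ℂ[X]) ^ e) ∈
            Submodule.span ℂ ((Submodule.span ℂ (insert (1 : ℂ[X]) (Set.range y)) : Set ℂ[X]) *
              (Submodule.span ℂ (insert (1 : ℂ[X]) (Set.range y)) : Set ℂ[X]))) →
          (s + 1) ^ 2400 ≤ m ^ 1121 * Nat.choose (m + 29) 30 ^ 20 →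
          ∃ S T : Multiset (Fin m), S ≠ T ∧ Multiset.card S ≤ 30 ∧ Multiset.card T ≤ 30 ∧
            (S.map d).sum = (T.map d).sum := by
  obtain ⟨m₀, h⟩ := relation_of_complete_pool
  refine ⟨m₀, fun m hm d s Γ y hΓ hy A h0 hA hcomp hs => h m hm d s Γ y hΓ hy A h0 hA ?_⟩
  calc (A + A).card ^ 1200 ≤ ((s + 1) ^ 2) ^ 1200 :=
        pow_le_pow_left₀ (Nat.zero_le _) (card_sumset_le_of_complete y A hcomp) 1200
    _ = (s + 1) ^ 2400 := by rw [← pow_mul]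
    _ ≤ m ^ 1121 * Nat.choose (m + 29) 30 ^ 20 := hs

end PolySwallowSupport

end Summit.ValiantsHypothesis.ValiantsHypothesis.Theorems
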